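import Literature.MathematicalPhysics.KineticTheory.SiteChainHamiltonianFlow
import Literature.MathematicalPhysics.KineticTheory.SiteChainLaSalleUniqueness
import Literature.MathematicalPhysics.KineticTheory.LangevinChainScaleCloseness
import HarnessLib

/-!
# Quartic site-inhomogeneous limit chains: unique continuation and the uniform dissipation bound (CEHR Prop. 5.14)

Topic `Literature/MathematicalPhysics/KineticTheory`, grouping namespace `…KineticTheory.HeatConduction`.
Cuneo–Eckmann–Hairer–Rey-Bellet, EJP **23** (2018) no. 55, §5.1: in the interaction scaling a chain
with quartic cells converges to the frictionless Hamiltonian system (5.10) of a LIMIT CHAIN keeping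
only the degree-4 terms; Prop. 5.14 is a uniform lower bound `∫₀^λ ∑_b γ_b p̂_b² dσ ≥ C > 0` on an
energy shell (unique continuation, Rem. 5.15, and compactness). Proved here for the SITE-DEPENDENT
quartic chains

  `U_i(q) = a_i q⁴/4` (`a_i ≥ 0`, site `0` pinned: `a_0 > 0`),  `V_i(r) = β r⁴/4` (`β > 0`),  `γ = 0`,

written as hypotheses `hPU : ∀ i q, P.U i q = a i * q ^ 4 / 4`, `hPV : ∀ i r, P.V i r = β * r ^ 4 / 4`
on a `P : SiteChain` (structure literals, e.g. the cell-block limit chain `a i = if i < k then lam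
else 0` of a dilute cell chain, are instances by `rfl`). Sitewise twin of `LangevinChainLimitFlow.lean`
(uniform pinning `limitChain lam β`), whose unique continuation only uses `a_i ≥ 0`:

* sitewise calculus (`quartic_deriv_U/V`, `quartic_dPotential_eq`), Euler's identity
  `∑ q_i ∂_iΦ = 4Φ` (`quartic_euler`) and `H = 0` at a resting critical point;
* `quartic_norm_le_of_hamiltonian_le` — **coercivity**: `H ≤ h ⟹ ‖(q, p)‖ ≤ N(1 + 4h/a_0 + 4h/β) + h + 1`
  (site `0` is pinned, the quartic bonds tie every further site to it);
* `quartic_hamiltonian_eq_zero_of_resting` — **unique continuation** along the bonds from the left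
  bath site (CEHR Prop. 5.14 / Rem. 5.15: `p̂_0 ≡ 0` on `[0, Λ]` forces `Ĥ = 0`);
* `quartic_dissipation_pos` — positivity `∫₀^Λ p̂_0² > 0` for EVERY continuous classical solution of
  (5.10) on `(0, Λ)` with positive energy (shift to an interior window, energy conservation);
* `quartic_exists_dissipation_lower_bound` — **CEHR Prop. 5.14**: some `ε > 0` bounds
  `∫₀^Λ p̂_0(σ)² dσ` below for every classical solution started in the shell `h₁ ≤ Ĥ ≤ h₀`
  (`h₁ > 0`), flow-free (uniqueness and joint continuity of the truncated Hamiltonian flow of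
  `SiteChainHamiltonianFlow.lean`, compactness of the shell, minimum of a positive continuous function).

## References

* N. Cuneo, J.-P. Eckmann, M. Hairer, L. Rey-Bellet, *Non-equilibrium steady states for networks of
  oscillators*, EJP **23** (2018) no. 55, §5.1 eqs. (5.9)–(5.11), Prop. 5.14, Rem. 5.15, Rem. 2.10.
-/

noncomputable section

open MeasureTheory Filter Topology Set Metric
open scoped NNReal

namespace Literature.MathematicalPhysics.KineticTheory.HeatConduction

open Literature.MathematicalPhysics.KineticTheory Literature.Analysis.ODE

variable {N : ℕ}

namespace SiteChain

variable {P : SiteChain} {a : ℕ → ℝ} {β : ℝ}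

/-! ### Sitewise calculus of the quartic chain -/

/-- The quartic pinning `a_i q⁴/4` is smooth. [folklore] -/
theorem quartic_contDiff_U (hPU : ∀ i q, P.U i q = a i * q ^ 4 / 4) (i : ℕ) {n : WithTop ℕ∞} :
    ContDiff ℝ n (P.U i) := by
  rw [show P.U i = fun q => a i * q ^ 4 / 4 from funext (hPU i)]
  fun_prop

/-- The quartic coupling `β r⁴/4` is smooth. [folklore] -/
theorem quartic_contDiff_V (hPV : ∀ i r, P.V i r = β * r ^ 4 / 4) (i : ℕ) {n : WithTop ℕ∞} :
    ContDiff ℝ n (P.V i) := by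
  rw [show P.V i = fun r => β * r ^ 4 / 4 from funext (hPV i)]
  fun_prop

/-- `U_i'(q) = a_i q³`. [folklore] -/
theorem quartic_deriv_U (hPU : ∀ i q, P.U i q = a i * q ^ 4 / 4) (i : ℕ) (q : ℝ) :
    deriv (P.U i) q = a i * q ^ 3 := by
  have h : P.U i = fun q => a i * q ^ 4 / 4 := funext (hPU i)
  have hd : HasDerivAt (fun q : ℝ => a i * q ^ 4 / 4) (a i * ((4 : ℕ) * q ^ (4 - 1)) / 4) q :=
    (((hasDerivAt_pow 4 q).const_mul (a i)).div_const 4)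
  rw [h, hd.deriv]
  norm_num; ring

/-- `V_i'(r) = β r³`. [folklore] -/
theorem quartic_deriv_V (hPV : ∀ i r, P.V i r = β * r ^ 4 / 4) (i : ℕ) (r : ℝ) :
    deriv (P.V i) r = β * r ^ 3 := by
  have h : P.V i = fun r => β * r ^ 4 / 4 := funext (hPV i)
  have hd : HasDerivAt (fun r : ℝ => β * r ^ 4 / 4) (β * ((4 : ℕ) * r ^ (4 - 1)) / 4) r :=
    (((hasDerivAt_pow 4 r).const_mul β).div_const 4)
  rw [h, hd.deriv]
  norm_num; ring

/-- `U_i ≥ 0` for `a_i ≥ 0`. [folklore] -/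
theorem quartic_U_nonneg (hPU : ∀ i q, P.U i q = a i * q ^ 4 / 4) (ha : ∀ i, 0 ≤ a i) (i : ℕ)
    (q : ℝ) : 0 ≤ P.U i q := by
  rw [hPU]
  have := ha i
  positivity

/-- `V_i ≥ 0` for `β ≥ 0`. [folklore] -/
theorem quartic_V_nonneg (hPV : ∀ i r, P.V i r = β * r ^ 4 / 4) (hβ : 0 ≤ β) (i : ℕ) (r : ℝ) :
    0 ≤ P.V i r := by
  rw [hPV]
  positivity

/-- **The force of the quartic chain**: `∂Φ/∂q_i = a_i q_i³ + [1 ≤ i] β(q_i - q_{i-1})³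
- [i+1 < N] β(q_{i+1} - q_i)³`. [cite: CuneoEckmannHairerReyBellet2018, §5.1 eq. (5.10)] -/
theorem quartic_dPotential_eq (hPU : ∀ i q, P.U i q = a i * q ^ 4 / 4)
    (hPV : ∀ i r, P.V i r = β * r ^ 4 / 4) (N : ℕ) (i : Fin N) (q : Fin N → ℝ) :
    P.dPotential N i q = a i.val * q i ^ 3 +
      (if h : 0 < i.val then β * (q i - q ⟨i.val - 1, by omega⟩) ^ 3 else 0) -
        (if h : i.val + 1 < N then β * (q ⟨i.val + 1, h⟩ - q i) ^ 3 else 0) := by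
  rw [P.dPotential_eq_closed N i q, quartic_deriv_U hPU]
  simp only [quartic_deriv_V hPV]

/-- **Euler's identity for the degree-4 homogeneous potential**: `∑_i q_i ∂Φ/∂q_i = 4 Φ(q)`,
`Φ(q) = ∑_i U_i(q_i) + ∑_{bonds} V_i(q_{i+1} - q_i)`. [folklore] -/
theorem quartic_euler (hPU : ∀ i q, P.U i q = a i * q ^ 4 / 4) (hPV : ∀ i r, P.V i r = β * r ^ 4 / 4)
    (N : ℕ) (q : Fin N → ℝ) :
    ∑ i, q i * P.dPotential N i q =
      4 * ((∑ i : Fin N, P.U i.val (q i)) + ∑ i : Fin N, ∑ j : Fin N,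
        if j.val = i.val + 1 then P.V i.val (q j - q i) else 0) := by
  rw [P.sum_mul_dPotential N q, mul_add, Finset.mul_sum, Finset.mul_sum]
  congr 1
  · refine Finset.sum_congr rfl fun i _ => ?_
    rw [quartic_deriv_U hPU, hPU]
    ring
  · refine Finset.sum_congr rfl fun k _ => ?_
    rw [Finset.mul_sum]
    refine Finset.sum_congr rfl fun l _ => ?_
    split_ifs
    · rw [quartic_deriv_V hPV, hPV]
      ring
    · simp

/-- A resting critical point of the quartic chain has zero energy: if all momenta and all forces
vanish then `H = ∑ p²/2 + Φ = ¼ ∑ q_i ∂_iΦ = 0` (Euler). [folklore] -/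
theorem quartic_hamiltonian_eq_zero_of_rest (hPU : ∀ i q, P.U i q = a i * q ^ 4 / 4)
    (hPV : ∀ i r, P.V i r = β * r ^ 4 / 4) (N : ℕ) (x : PhaseSpace N) (hp : ∀ i, x.2 i = 0)
    (hF : ∀ i, P.dPotential N i x.1 = 0) : P.hamiltonian N x = 0 := by
  have h1 : ∑ i, x.2 i ^ 2 / 2 = 0 := Finset.sum_eq_zero fun i _ => by simp [hp i]
  have h2 := quartic_euler hPU hPV N x.1
  have h3 : ∑ i, x.1 i * P.dPotential N i x.1 = 0 := Finset.sum_eq_zero fun i _ => by simp [hF i]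
  have h4 := P.hamiltonian_eq_kinetic_add N x.1 x.2
  rw [h1, zero_add] at h4
  change P.hamiltonian N x = _ at h4
  linarith

/-! ### Coercivity: the energy controls the phase point -/

/-- **Coercivity of the quartic energy** (`a_i ≥ 0`, `a_0 > 0`, `β > 0`): if `H(q, p) ≤ h` then
`‖(q, p)‖ ≤ N (1 + 4h/a_0 + 4h/β) + h + 1` — the pinned site `0` has `a_0 q_0⁴/4 ≤ h`, each bond
`β(q_{i+1} - q_i)⁴/4 ≤ h` ties the next site, and `p_i²/2 ≤ h`. [folklore] -/
theorem quartic_norm_le_of_hamiltonian_le (hPU : ∀ i q, P.U i q = a i * q ^ 4 / 4)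
    (hPV : ∀ i r, P.V i r = β * r ^ 4 / 4) (ha : ∀ i, 0 ≤ a i) (ha0 : 0 < a 0) (hβ : 0 < β)
    (N : ℕ) {x : PhaseSpace N} {h : ℝ} (hx : P.hamiltonian N x ≤ h) :
    ‖x‖ ≤ N * (1 + 4 * h / a 0 + 4 * h / β) + h + 1 := by
  have hU0 := quartic_U_nonneg hPU ha
  have hV0 := quartic_V_nonneg hPV hβ.le
  have h0 : 0 ≤ h := (P.hamiltonian_nonneg_of_nonneg hU0 hV0 N x).trans hx
  set B : ℝ := 1 + 4 * h / a 0 + 4 * h / β with hB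
  have hCa : (0 : ℝ) ≤ 4 * h / a 0 := by positivity
  have hCb : (0 : ℝ) ≤ 4 * h / β := by positivity
  have hB1 : 1 + 4 * h / β ≤ B := by linarith
  have hB0 : 0 ≤ B := le_trans (by positivity) hB1
  -- positions, by induction along the bonds from the pinned site `0`
  have hind : ∀ n : ℕ, ∀ hn : n < N, |x.1 ⟨n, hn⟩| ≤ (n + 1) * B := by
    intro n
    induction n with
    | zero =>
      intro hn
      have hsite := (P.site_le_hamiltonian hU0 hV0 N x ⟨0, hn⟩).trans hx
      rw [hPU] at hsite
      have hq4 : x.1 ⟨0, hn⟩ ^ 4 ≤ 4 * h / a 0 := by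
        rw [le_div_iff₀ ha0]
        nlinarith [sq_nonneg (x.2 ⟨0, hn⟩)]
      have h1 := (abs_le_max_one_of_pow_four_le hq4).trans
        (max_le (by linarith) (by linarith) : max 1 (4 * h / a 0) ≤ 1 + 4 * h / a 0)
      push_cast
      linarith
    | succ m ih =>
      intro hn
      have hm : m < N := by omega
      have hbond := (P.bond_le_hamiltonian hU0 hV0 N x (k := ⟨m, hm⟩) (l := ⟨m + 1, hn⟩) rfl).trans hx
      rw [hPV] at hbond
      have hr4 : (x.1 ⟨m + 1, hn⟩ - x.1 ⟨m, hm⟩) ^ 4 ≤ 4 * h / β := by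
        rw [le_div_iff₀ hβ]
        linarith
      have hr := ((abs_le_max_one_of_pow_four_le hr4).trans
        (max_le (by linarith) (by linarith) : max 1 (4 * h / β) ≤ 1 + 4 * h / β)).trans hB1
      have hprev := ih hm
      have htri := abs_sub_abs_le_abs_sub (x.1 ⟨m + 1, hn⟩) (x.1 ⟨m, hm⟩)
      push_cast
      linarith
  have hR0 : 0 ≤ N * B + h + 1 := by positivity
  rw [Prod.norm_def, max_le_iff]
  constructor
  · refine (pi_norm_le_iff_of_nonneg hR0).2 fun i => ?_
    rw [Real.norm_eq_abs]
    have h1 := hind i.val i.isLt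
    have h2 : ((i.val : ℝ) + 1) * B ≤ N * B :=
      mul_le_mul_of_nonneg_right (by exact_mod_cast Nat.succ_le_of_lt i.isLt) hB0
    linarith
  · refine (pi_norm_le_iff_of_nonneg hR0).2 fun i => ?_
    rw [Real.norm_eq_abs]
    have hsite := (P.site_le_hamiltonian hU0 hV0 N x i).trans hx
    have hp := abs_le_half_add_sq_half (x.2 i)
    have hU := hU0 i.val (x.1 i)
    have : 0 ≤ (N : ℝ) * B := by positivity
    linarith

/-! ### Unique continuation: a left bath site at rest forces zero energy -/

/-- **Unique continuation for the quartic chain** (CEHR Prop. 5.14 / Rem. 5.15: "assume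
`p̂_b(σ) ≡ 0` on `[0, λ]` … the total force on `b` vanishes … by C4 `q̂_b - q̂_v` is constant …
proceeding inductively no mass moves … only possible if `Ĥ(ẑ₀) = 0`"): if a solution of the
frictionless quartic system (`β > 0`, `N ≥ 1`) has `p̂_0 ≡ 0` on `[0, Λ]`, `Λ > 0`, its energy
vanishes: `p̂_k ≡ 0 ⟹ q̂_k` constant, `∂_kΦ(q̂) ≡ 0 ⟹ β(q̂_{k+1} - q̂_k)³` constant ⟹ `q̂_{k+1}`
constant ⟹ `p̂_{k+1} ≡ 0`; at the end a resting critical point of the homogeneous `Φ`, so `Ĥ = 0`.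
[cite: CuneoEckmannHairerReyBellet2018, Prop 5.14 and Rem 5.15] -/
theorem quartic_hamiltonian_eq_zero_of_resting (hPU : ∀ i q, P.U i q = a i * q ^ 4 / 4)
    (hPV : ∀ i r, P.V i r = β * r ^ 4 / 4) (hγ : P.γ = 0) (hβ : 0 < β) (hN : 0 < N)
    {Λ : ℝ} (hΛ : 0 < Λ) {z : ℝ → PhaseSpace N}
    (hz : ∀ σ ∈ Icc 0 Λ, HasDerivAt z (P.langevinDrift N (z σ)) σ)
    (hp0 : ∀ σ ∈ Icc 0 Λ, (z σ).2 ⟨0, hN⟩ = 0) :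
    P.hamiltonian N (z 0) = 0 := by
  have hUd : ∀ i, Differentiable ℝ (P.U i) := fun i =>
    (quartic_contDiff_U hPU i).differentiable one_ne_zero
  have hVd : ∀ i, Differentiable ℝ (P.V i) := fun i =>
    (quartic_contDiff_V hPV i).differentiable one_ne_zero
  have h0 : (0 : ℝ) ∈ Icc 0 Λ := ⟨le_rfl, hΛ.le⟩
  -- component derivatives
  have hq' : ∀ i, ∀ σ ∈ Icc 0 Λ, HasDerivAt (fun s => (z s).1 i) ((z σ).2 i) σ := by
    intro i σ hσ
    have h1 :=
      (ContinuousLinearMap.fst ℝ (Fin N → ℝ) (Fin N → ℝ)).hasFDerivAt.comp_hasDerivAt σ (hz σ hσ)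
    simpa [SiteChain.langevinDrift] using (hasDerivAt_pi.1 h1) i
  have hp' : ∀ i, ∀ σ ∈ Icc 0 Λ,
      HasDerivAt (fun s => (z s).2 i) (-(P.dPotential N i (z σ).1)) σ := by
    intro i σ hσ
    have h1 :=
      (ContinuousLinearMap.snd ℝ (Fin N → ℝ) (Fin N → ℝ)).hasFDerivAt.comp_hasDerivAt σ (hz σ hσ)
    simpa [SiteChain.langevinDrift, hγ, P.partialQ_hamiltonian_eq_dPotential hUd hVd] using
      (hasDerivAt_pi.1 h1) i
  -- from `p̂_i ≡ 0`: `q̂_i` is constant and `∂_iΦ ∘ q̂ ≡ 0`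
  have hconst : ∀ i, (∀ σ ∈ Icc 0 Λ, (z σ).2 i = 0) →
      ∀ σ ∈ Icc 0 Λ, (z σ).1 i = (z 0).1 i := by
    intro i hi
    exact eq_of_hasDerivAt_zero_Icc fun σ hσ => by simpa [hi σ hσ] using hq' i σ hσ
  have hforce : ∀ i, (∀ σ ∈ Icc 0 Λ, (z σ).2 i = 0) →
      ∀ σ ∈ Icc 0 Λ, P.dPotential N i (z σ).1 = 0 := by
    intro i hi σ hσ
    have := deriv_eq_zero_of_eqOn_Icc hΛ (hp' i) (c := 0) hi σ hσ
    linarith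
  have hinj : Function.Injective fun x : ℝ => x ^ 3 :=
    (Odd.strictMono_pow (⟨1, by norm_num⟩ : Odd 3)).injective
  -- induction along the chain: all momenta vanish identically
  have hall : ∀ k : ℕ, ∀ j ≤ k, ∀ (hj : j < N), ∀ σ ∈ Icc 0 Λ, (z σ).2 ⟨j, hj⟩ = 0 := by
    intro k
    induction k with
    | zero =>
      intro j hj hjN σ hσ
      obtain rfl : j = 0 := Nat.le_zero.1 hj
      exact hp0 σ hσ
    | succ k ih =>
      intro j hj hjN σ hσ
      rcases Nat.lt_or_ge j (k + 1) with hjk | hjk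
      · exact ih j (Nat.lt_succ_iff.1 hjk) hjN σ hσ
      · obtain rfl : j = k + 1 := le_antisymm hj hjk
        have hkN : k < N := by omega
        have hpk : ∀ σ ∈ Icc 0 Λ, (z σ).2 ⟨k, hkN⟩ = 0 := ih k le_rfl hkN
        have hqk : ∀ σ ∈ Icc 0 Λ, (z σ).1 ⟨k, hkN⟩ = (z 0).1 ⟨k, hkN⟩ := hconst _ hpk
        have hFk : ∀ σ ∈ Icc 0 Λ, P.dPotential N ⟨k, hkN⟩ (z σ).1 = 0 := hforce _ hpk
        -- the bond `(k, k+1)`: `(q̂_{k+1}(σ) - q̂_k(0))³` is constant in `σ`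
        have hcube : ∀ σ ∈ Icc 0 Λ, ((z σ).1 ⟨k + 1, hjN⟩ - (z 0).1 ⟨k, hkN⟩) ^ 3 =
            ((z 0).1 ⟨k + 1, hjN⟩ - (z 0).1 ⟨k, hkN⟩) ^ 3 := by
          intro σ hσ
          have e1 := hFk σ hσ
          have e0 := hFk 0 h0
          rw [quartic_dPotential_eq hPU hPV] at e1 e0
          simp only [dif_pos hjN] at e1 e0
          by_cases hk0 : 0 < k
          · simp only [dif_pos hk0] at e1 e0
            have hpk1 : ∀ σ ∈ Icc 0 Λ, (z σ).2 ⟨k - 1, by omega⟩ = 0 :=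
              ih (k - 1) (by omega) (by omega)
            have hqk1 := hconst _ hpk1 σ hσ
            rw [hqk σ hσ, hqk1] at e1
            have : β * ((z σ).1 ⟨k + 1, hjN⟩ - (z 0).1 ⟨k, hkN⟩) ^ 3 =
                β * ((z 0).1 ⟨k + 1, hjN⟩ - (z 0).1 ⟨k, hkN⟩) ^ 3 := by linarith
            exact mul_left_cancel₀ hβ.ne' this
          · simp only [dif_neg hk0] at e1 e0
            rw [hqk σ hσ] at e1
            have : β * ((z σ).1 ⟨k + 1, hjN⟩ - (z 0).1 ⟨k, hkN⟩) ^ 3 =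
                β * ((z 0).1 ⟨k + 1, hjN⟩ - (z 0).1 ⟨k, hkN⟩) ^ 3 := by linarith
            exact mul_left_cancel₀ hβ.ne' this
        have hqk1c : ∀ σ ∈ Icc 0 Λ, (z σ).1 ⟨k + 1, hjN⟩ = (z 0).1 ⟨k + 1, hjN⟩ := by
          intro σ hσ
          have := hinj (hcube σ hσ)
          linarith
        exact deriv_eq_zero_of_eqOn_Icc hΛ (hq' ⟨k + 1, hjN⟩) hqk1c σ hσ
  have hpall : ∀ i : Fin N, ∀ σ ∈ Icc 0 Λ, (z σ).2 i = 0 := fun i =>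
    hall i.val i.val le_rfl i.isLt
  -- at time `0`: no momentum, and a critical point of the homogeneous potential
  exact quartic_hamiltonian_eq_zero_of_rest hPU hPV N (z 0) (fun i => hpall i 0 h0)
    fun i => hforce i (hpall i) 0 h0

/-! ### Positivity and the uniform lower bound of the dissipation (CEHR Prop. 5.14) -/

/-- **Positivity of the dissipation at the left bath site** (CEHR Prop. 5.14, first step:
"`∫₀^λ ∑_b γ_b p̂_b² dσ > 0` if `Ĥ(ẑ₀) > 0`"): every continuous classical solution `y` of the
frictionless quartic system on `(0, Λ)` (`β > 0`, `N ≥ 1`, `Λ > 0`) with `Ĥ(y(0)) > 0` has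
`∫₀^Λ p̂_0(σ)² dσ > 0` — otherwise `p̂_0 ≡ 0` on `[0, Λ]`, unique continuation on the interior
window `[Λ/4, 3Λ/4]` gives zero energy there, contradicting energy conservation.
[cite: CuneoEckmannHairerReyBellet2018, Prop 5.14] -/
theorem quartic_dissipation_pos (hPU : ∀ i q, P.U i q = a i * q ^ 4 / 4)
    (hPV : ∀ i r, P.V i r = β * r ^ 4 / 4) (hγ : P.γ = 0) (hβ : 0 < β) (hN : 0 < N)
    {Λ : ℝ} (hΛ : 0 < Λ) {y : ℝ → PhaseSpace N} (hyc : Continuous y)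
    (hy : ∀ t ∈ Ioo 0 Λ, HasDerivAt y (P.langevinDrift N (y t)) t)
    (hpos : 0 < P.hamiltonian N (y 0)) :
    0 < ∫ s in (0 : ℝ)..Λ, (y s).2 ⟨0, hN⟩ ^ 2 := by
  have hU1 : ∀ i, ContDiff ℝ 1 (P.U i) := fun i => quartic_contDiff_U hPU i
  have hV1 : ∀ i, ContDiff ℝ 1 (P.V i) := fun i => quartic_contDiff_V hPV i
  have hpc : Continuous fun s => (y s).2 ⟨0, hN⟩ :=
    (continuous_apply _).comp (continuous_snd.comp hyc)
  by_contra hle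
  have hint0 : ∫ s in (0 : ℝ)..Λ, (y s).2 ⟨0, hN⟩ ^ 2 = 0 :=
    le_antisymm (not_lt.1 hle) (intervalIntegral.integral_nonneg hΛ.le fun s _ => sq_nonneg _)
  have hzero := eq_zero_of_integral_eq_zero (hpc.pow 2) (fun s => sq_nonneg _) hΛ hint0
  have hp0 : ∀ s ∈ Icc 0 Λ, (y s).2 ⟨0, hN⟩ = 0 := fun s hs =>
    pow_eq_zero_iff two_ne_zero |>.1 (hzero s hs)
  -- shift to the interior window `[Λ/4, 3Λ/4]`, where `y` is differentiable from both sides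
  set z : ℝ → PhaseSpace N := fun σ => y (σ + Λ / 4) with hz
  have hzd : ∀ σ ∈ Icc 0 (Λ / 2), HasDerivAt z (P.langevinDrift N (z σ)) σ := by
    intro σ hσ
    exact (hy _ ⟨by linarith [hσ.1], by linarith [hσ.2]⟩).comp_add_const σ (Λ / 4)
  have hzp : ∀ σ ∈ Icc 0 (Λ / 2), (z σ).2 ⟨0, hN⟩ = 0 := fun σ hσ =>
    hp0 _ ⟨by linarith [hσ.1], by linarith [hσ.2]⟩
  have hH0 := quartic_hamiltonian_eq_zero_of_resting hPU hPV hγ hβ hN (half_pos hΛ) hzd hzp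
  have hcons := P.hamiltonian_eq_of_hasDerivAt_langevinDrift hU1 hV1 hγ hyc.continuousOn hy (Λ / 4)
    ⟨by linarith, by linarith⟩
  rw [show z 0 = y (Λ / 4) by simp [hz]] at hH0
  linarith

/-- **The uniform dissipation bound — CEHR Proposition 5.14 for the site-dependent quartic limit
chain** ("there is a constant `C > 0` such that for every initial condition `ẑ₀` with
`Ĥ(ẑ₀) ∈ [1/4, 2]` the solution of (5.10) satisfies `∫₀^λ ∑_b γ_b p̂_b² dσ ≥ C`"), flow-free:
for `a_i ≥ 0`, `a_0 > 0`, `β > 0`, `N ≥ 1`, `h₁ > 0`, `Λ > 0` some `ε > 0` bounds `∫₀^Λ p̂_0(σ)² dσ`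
below for every continuous classical solution `y` of `y' = Y(y)` on `(0, Λ)` started in the shell
`h₁ ≤ Ĥ ≤ h₀` (uniqueness identifies `y` with the jointly continuous truncated Hamiltonian flow;
compact shell; minimum of a positive continuous function). [cite: CuneoEckmannHairerReyBellet2018, Prop 5.14] -/
theorem quartic_exists_dissipation_lower_bound (hPU : ∀ i q, P.U i q = a i * q ^ 4 / 4)
    (hPV : ∀ i r, P.V i r = β * r ^ 4 / 4) (hγ : P.γ = 0) (ha : ∀ i, 0 ≤ a i) (ha0 : 0 < a 0)
    (hβ : 0 < β) (hN : 0 < N) {h₁ : ℝ} (h₀ : ℝ) {Λ : ℝ} (hh₁ : 0 < h₁) (hΛ : 0 < Λ) :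
    ∃ ε : ℝ, 0 < ε ∧ ∀ (x : PhaseSpace N) (y : ℝ → PhaseSpace N),
      h₁ ≤ P.hamiltonian N x → P.hamiltonian N x ≤ h₀ → Continuous y → y 0 = x →
      (∀ t ∈ Ioo 0 Λ, HasDerivAt y (P.langevinDrift N (y t)) t) →
      ε ≤ ∫ s in (0 : ℝ)..Λ, (y s).2 ⟨0, hN⟩ ^ 2 := by
  have hU2 : ∀ i, ContDiff ℝ 2 (P.U i) := fun i => quartic_contDiff_U hPU i
  have hV2 : ∀ i, ContDiff ℝ 2 (P.V i) := fun i => quartic_contDiff_V hPV i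
  set R : ℝ := max (N * (1 + 4 * h₀ / a 0 + 4 * h₀ / β) + h₀ + 1) 1 with hRdef
  have hR : 0 < R := lt_max_of_lt_right one_pos
  have hρ : ∀ z : PhaseSpace N, P.hamiltonian N z ≤ h₀ → ‖z‖ ≤ R := fun z hz =>
    le_max_of_le_left (quartic_norm_le_of_hamiltonian_le hPU hPV ha ha0 hβ N hz)
  set D : PhaseSpace N → ℝ := fun x =>
    ∫ s in (0 : ℝ)..Λ, (drivenTruncSol (P.langevinDrift N) R x 0 s).2 ⟨0, hN⟩ ^ 2 with hD
  have hDc : Continuous D :=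
    continuous_integral_comp_truncFlow hU2 hV2 N hR (φ := fun z : PhaseSpace N => z.2 ⟨0, hN⟩ ^ 2)
      (((continuous_apply _).comp continuous_snd).pow 2) 0 Λ
  have hHc : Continuous (P.hamiltonian N) :=
    P.continuous_hamiltonian N (fun i => (hU2 i).continuous) (fun i => (hV2 i).continuous)
  set K : Set (PhaseSpace N) := {x | h₁ ≤ P.hamiltonian N x} ∩ {x | P.hamiltonian N x ≤ h₀} with hK
  have hKc : IsCompact K := by
    refine (isCompact_closedBall (0 : PhaseSpace N) R).of_isClosed_subset
      ((isClosed_le continuous_const hHc).inter (isClosed_le hHc continuous_const)) fun x hx => ?_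
    rw [mem_closedBall, dist_zero_right]
    exact hρ x hx.2
  -- every solution from `x` with `H(x) ≤ h₀` has the dissipation `D x` of the flow
  have hDy : ∀ (x : PhaseSpace N) (y : ℝ → PhaseSpace N), P.hamiltonian N x ≤ h₀ → Continuous y →
      y 0 = x → (∀ t ∈ Ioo 0 Λ, HasDerivAt y (P.langevinDrift N (y t)) t) →
      ∫ s in (0 : ℝ)..Λ, (y s).2 ⟨0, hN⟩ ^ 2 = D x := by
    intro x y hx hyc hy0 hy
    have heq := eqOn_truncFlow_of_hasDerivAt hU2 hV2 N hR hγ hρ hx hyc hy0 hy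
    refine intervalIntegral.integral_congr fun s hs => ?_
    rw [uIcc_of_le hΛ.le] at hs
    simp only [heq hs]
  -- and `D x > 0` on the shell
  have hDpos : ∀ x : PhaseSpace N, h₁ ≤ P.hamiltonian N x → P.hamiltonian N x ≤ h₀ → 0 < D x := by
    intro x hx1 hx0
    have hψd : ∀ t ∈ Ioo 0 Λ, HasDerivAt (drivenTruncSol (P.langevinDrift N) R x 0)
        (P.langevinDrift N (drivenTruncSol (P.langevinDrift N) R x 0 t)) t := fun t ht =>
      hasDerivAt_truncFlow_langevinDrift hU2 hV2 N hR hγ hρ hx0 ht.1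
    refine quartic_dissipation_pos hPU hPV hγ hβ hN hΛ (continuous_truncFlow hU2 hV2 N hR x) hψd ?_
    rw [truncFlow_zero hU2 hV2 N hR x]; linarith
  by_cases hne : K.Nonempty
  · obtain ⟨x₀, hx₀, hmin⟩ := hKc.exists_isMinOn hne hDc.continuousOn
    refine ⟨D x₀, hDpos x₀ hx₀.1 hx₀.2, fun x y hx1 hx0 hyc hy0 hy => ?_⟩
    rw [hDy x y hx0 hyc hy0 hy]
    exact hmin ⟨hx1, hx0⟩
  · exact ⟨1, one_pos, fun x _ hx1 hx0 _ _ _ => absurd ⟨x, hx1, hx0⟩ hne⟩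

end SiteChain

end Literature.MathematicalPhysics.KineticTheory.HeatConduction
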